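import Summits.QuantumFields.YangMills.Theorems.SwapVirialDeficitBlowUpPeriodicDominator
import HarnessLib

/-!
# The PERIODIC massive-mode rung, brick PM-I: the TWO-SCALE CHART `(u, s) = (ρ, t/ρ²)` — the kernel identity with CONSTANT weight
# `K_t(a₀, ρ) = 4π · 𝟙{a₀²+ρ²<1} · ρ⁻¹ · V(ρ, t/ρ², a₀)` and the crude bound `V ≤ Vmax`
# (free-hands support of ⟨stmt-QuantumFields-24196⟩ `SwapVirialDeficit.ToronSoftnessSharp`; LEAD memo `sfw-p2-g96-memo-24196-PM-design.md` §0 ∕ §2½,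
# interface (I1′)(I2′) to w3 g64's PM-III `…BlowUpPeriodicTwoScaleExtract`; consumes ✓PH `ringMeasure_ringDeficit_le_eq_kernel` ∕
# `lintegral_volume3_eq_scaleQ3`, ✓PD-II `periodicKernel_le_radK`, K4's ✓`radK_eq` ∕ ✓`Vrad_le_domSet4` ∕ ✓`volume_domSet4_lt_top`)

PM (the middle-region two-scale bounds of ✓`periodicPrincipalLogLimit_of_twoScale`) is a JOINT limit in two small parameters.  At hub `(a₀, ρ)` and scale `t`
rescale the three non-hub leaders by K4's second blow-up ✓`scaleQ3 m l` with `(m, l) := (ρ, ρ⁻¹)` (`|m l²|³ = ρ⁻³`) and set `u := ρ`, `s := t/ρ²`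
(`t = u²s`).  Then every RAW letter of ✓`periodicBlowUpPoint` is AFFINE in the monomials `u, us, u²s` — leaders `(x₀, u·x_I, us·x_J, us·x_K)`, hub
`(a₀, u, 0, 0) = hubAt a₀ u²`, followers `(y₀, u²s·Im y)` — and:
* §1 `twoScaleFibre L u s a₀` = the `scaleQ3 u u⁻¹`-pullback of the hub section of `periodicBlowUpSet L 0 1 (u²s) ((u²s)²)` at `hubAt a₀ u²` (PJ6's
  threshold `deficit ≤ t²`), `twoScaleVolume L u s a₀ := (vol³ ⊗ vol^{Fol})(twoScaleFibre L u s a₀)`, measurability, the Tonelli form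
  `twoScaleVolume = ∫⁻ w', vol^{Fol}(section) dvol³`;
* §2 ★ `periodicFibreMass_hubAt_eq_twoScaleVolume` (`Ψ_t(hubAt a₀ ρ²) = ofReal(ρ⁻¹)³ · V(ρ, t/ρ², a₀)`) and ★★ `periodicKernel_eq_twoScaleVolume`
  (I1′): for `ρ > 0` and `a₀² + ρ² < 1` (any `t`),
  `periodicKernel L 0 1 t (t²) (a₀, ρ) = ofReal(4π) · ofReal ρ⁻¹ · twoScaleVolume L ρ (t/ρ²) a₀` — the log-squeeze weight `ρ⁻¹` falls out EXACTLY
  (`ρ²` of ✓`periodicKernel` against the Jacobian `ρ⁻³`), with NO `a₀`-dependent weight; ★ `periodicKernel_eq_zero_of_not_mem` off the disc;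
* §3 ★★ `twoScaleVolume_le` (I2′): `∃ Vmax ≠ ∞, ∀ u s a₀, 0 < u → 0 < s → a₀² + u² < 1 → twoScaleVolume L u s a₀ ≤ Vmax`
  (✓PD-II `periodicKernel_le_radK` at `r = 1`, `R = 20L²`, and K4's `radK ≤ 𝟙·(a₀²+ρ²)^{3/2}/(64ρ)·vol(domSet4)`).
So on the middle region `ρ ∈ (A√t, δ]` of the log-squeeze BOTH chart parameters are small (`u ≤ δ`, `s < A⁻²`), and PM-III needs exactly one more input,
the joint two-scale limit (I3′) of `twoScaleVolume L u s a₀` as `(u, s) → (0⁺, 0⁺)` locally uniformly in `a₀` (PM-II, structure theorem `G = u⁴s²Φ`).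
Deliberately NOT here: the structure theorem, the dominator set, the DCT (PM-II), the extraction (PM-III).
HONEST LABEL: measure-theoretic bookkeeping (plumbing for a plan-level fixed-`L` rung of a DRAFT line); PM, ⟨24196⟩, ⟨24194⟩, ⟨24197⟩, ⟨24497⟩ NOT proved;
own crux ⟨22884⟩ OPEN (blocked-on ⟨19935⟩); the Yang–Mills mass gap is NOT proved; no summit is proved by a line.
LEAD seat ym-line-sfw-p2 g96 (cell ym-idea-1, free hands), `--supports stmt-QuantumFields-24196`.  Two `def`s, standard axioms, 0 `sorry`.
References: [cite: Luscher1983, §2]; [cite: GonzalezarroyoAltes1988]; [folklore].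
-/

set_option autoImplicit false

noncomputable section

open MeasureTheory Quaternion Set Filter Topology
open scoped Quaternion ENNReal BigOperators
open Literature.MathematicalPhysics.QuantumLattice
open Literature.MathematicalPhysics.QuantumFieldTheory hiding SU2
open Summit.QuantumFields.YangMills.Theorems.SwapTwistDeficit.ToronLog

attribute [local instance] Literature.Analysis.FluidPDE.Tao2016.quatMeasurableSpace
  Literature.Analysis.FluidPDE.Tao2016.quatBorelSpace
  Literature.MathematicalPhysics.QuantumLattice.secondCountableTopology_su2

namespace Summit.QuantumFields.YangMills.Theorems.SwapVirialDeficit.BlowUpRing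

open Summit.QuantumFields.YangMills.Theorems.FemtoTransferGap
open Summit.QuantumFields.YangMills.Theorems.FemtoTransferGap.TT
open Summit.QuantumFields.YangMills.Theorems.VirialFluxGap.RingDeficit
open Summit.QuantumFields.YangMills.Theorems.SwapVirialDeficit.ZeroModeGroup (scaleQ3 measurable_scaleQ3 radK radK_eq Vrad Vrad_le_domSet4 domSet4
  volume_domSet4_lt_top)
open Summit.QuantumFields.YangMills.Theorems.SwapVirialDeficit.BlowUp (pi_volume_followerBox_ne_top)

variable {L : ℕ} [NeZero L]

/-! ## §1 The two-scale fibre and its volume -/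

variable (L) in
/-- **The two-scale fibre** at chart parameters `(u, s)` and hub real part `a₀`: the `scaleQ3 u u⁻¹`-pullback (K4's second blow-up with
`(m, l) = (ρ, ρ⁻¹)`, `ρ = u`) of the hub section of the periodic blow-up event at scale `t = u²s`, threshold `t²`, hub `hubAt a₀ u²`.
In these coordinates every raw letter is affine in `u, us, u²s`. [folklore] -/
def twoScaleFibre (u s a₀ : ℝ) : Set (((ℍ × ℍ) × ℍ) × (Fol L → ℍ)) :=
  {q | (hubAt a₀ (u ^ 2), (scaleQ3 u u⁻¹ q.1, q.2)) ∈ periodicBlowUpSet L (fun _ => false) (fun _ => 1) (u ^ 2 * s) ((u ^ 2 * s) ^ 2)}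

variable (L) in
/-- **The two-scale fibre volume** `V(u, s, a₀) = (vol³ ⊗ vol^{Fol})(twoScaleFibre L u s a₀)`. [folklore] -/
def twoScaleVolume (u s a₀ : ℝ) : ℝ≥0∞ :=
  ((volume : Measure ((ℍ × ℍ) × ℍ)).prod (Measure.pi fun _ : Fol L => (volume : Measure ℍ))) (twoScaleFibre L u s a₀)

omit [NeZero L] in
/-- The chart map `q ↦ (hubAt a₀ u², (scaleQ3 u u⁻¹ q.1, q.2))` is measurable. [folklore] -/
theorem measurable_twoScaleChartMap (u a₀ : ℝ) :
    Measurable fun q : ((ℍ × ℍ) × ℍ) × (Fol L → ℍ) =>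
      ((hubAt a₀ (u ^ 2), (scaleQ3 u u⁻¹ q.1, q.2)) : ℍ × (((ℍ × ℍ) × ℍ) × (Fol L → ℍ))) :=
  measurable_const.prodMk (((measurable_scaleQ3 u u⁻¹).comp measurable_fst).prodMk measurable_snd)

/-- `twoScaleFibre` is measurable. [folklore] -/
theorem measurableSet_twoScaleFibre (u s a₀ : ℝ) : MeasurableSet (twoScaleFibre L u s a₀) :=
  (measurableSet_periodicBlowUpSet _ _ _ _).preimage (measurable_twoScaleChartMap u a₀)

/-- The `w'`-section of the two-scale fibre is the `scaleQ3 u u⁻¹ w'`-section of the hub section of the blow-up event. [folklore] -/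
theorem section_twoScaleFibre (u s a₀ : ℝ) (w' : (ℍ × ℍ) × ℍ) :
    Prod.mk w' ⁻¹' twoScaleFibre L u s a₀ =
      Prod.mk (scaleQ3 u u⁻¹ w') ⁻¹' (Prod.mk (hubAt a₀ (u ^ 2)) ⁻¹'
        periodicBlowUpSet L (fun _ => false) (fun _ => 1) (u ^ 2 * s) ((u ^ 2 * s) ^ 2)) := by
  ext y; rfl

/-- ★ **Tonelli form**: `twoScaleVolume L u s a₀ = ∫⁻ w', vol^{Fol}(section at w') dvol³`. [folklore] -/
theorem twoScaleVolume_eq_lintegral (u s a₀ : ℝ) :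
    twoScaleVolume L u s a₀ = ∫⁻ w' : (ℍ × ℍ) × ℍ, (Measure.pi fun _ : Fol L => (volume : Measure ℍ))
      (Prod.mk (scaleQ3 u u⁻¹ w') ⁻¹' (Prod.mk (hubAt a₀ (u ^ 2)) ⁻¹'
        periodicBlowUpSet L (fun _ => false) (fun _ => 1) (u ^ 2 * s) ((u ^ 2 * s) ^ 2))) ∂(volume : Measure ((ℍ × ℍ) × ℍ)) := by
  unfold twoScaleVolume
  rw [Measure.prod_apply (measurableSet_twoScaleFibre u s a₀)]
  rfl

/-! ## §2 The kernel identity (I1′): constant weight `4π`, log weight `ρ⁻¹` -/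

/-- ★ **The hub fibre mass through the second blow-up**: `Ψ_t(hubAt a₀ ρ²) = ofReal(ρ⁻¹)³ · V(ρ, t/ρ², a₀)` (threshold `t²`;
✓`lintegral_volume3_eq_scaleQ3` with `(m, l) = (ρ, ρ⁻¹)`, `|m l²| = ρ⁻¹`). [folklore] -/
theorem periodicFibreMass_hubAt_eq_twoScaleVolume (t : ℝ) {ρ : ℝ} (hρ : 0 < ρ) (a₀ : ℝ) :
    periodicFibreMass L (fun _ => false) (fun _ => 1) t (t ^ 2) (hubAt a₀ (ρ ^ 2)) =
      (ENNReal.ofReal ρ⁻¹ * ENNReal.ofReal ρ⁻¹ * ENNReal.ofReal ρ⁻¹) * twoScaleVolume L ρ (t / ρ ^ 2) a₀ := by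
  have hρ0 : ρ ≠ 0 := hρ.ne'
  have hml : ρ * ρ⁻¹ ^ 2 ≠ 0 := by positivity
  have habs : |ρ * ρ⁻¹ ^ 2| = ρ⁻¹ := by
    rw [abs_of_pos (by positivity)]; field_simp
  have hts : ρ ^ 2 * (t / ρ ^ 2) = t := by field_simp
  -- the hub section through the second blow-up
  have hpair : Measurable fun w : (ℍ × ℍ) × ℍ => ((hubAt a₀ (ρ ^ 2), w) : ℍ × ((ℍ × ℍ) × ℍ)) := measurable_const.prodMk measurable_id
  have h0 := (measurable_section_periodicBlowUpSet (L := L) (fun _ => false) (fun _ => 1) t (t ^ 2)).comp hpair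
  have hH : Measurable fun w : (ℍ × ℍ) × ℍ => (Measure.pi fun _ : Fol L => (volume : Measure ℍ))
      (Prod.mk w ⁻¹' (Prod.mk (hubAt a₀ (ρ ^ 2)) ⁻¹' periodicBlowUpSet L (fun _ => false) (fun _ => 1) t (t ^ 2))) := h0
  have e1 := lintegral_volume3_eq_scaleQ3 hml _ hH
  rw [habs] at e1
  have e2 : twoScaleVolume L ρ (t / ρ ^ 2) a₀ = ∫⁻ w : (ℍ × ℍ) × ℍ, (Measure.pi fun _ : Fol L => (volume : Measure ℍ))
      (Prod.mk (scaleQ3 ρ ρ⁻¹ w) ⁻¹' (Prod.mk (hubAt a₀ (ρ ^ 2)) ⁻¹' periodicBlowUpSet L (fun _ => false) (fun _ => 1) t (t ^ 2)))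
        ∂(((volume : Measure ℍ).prod (volume : Measure ℍ)).prod (volume : Measure ℍ)) := by
    rw [twoScaleVolume_eq_lintegral, hts]
    rfl
  rw [e2]
  exact e1

/-- ★★ **THE KERNEL IDENTITY (I1′)** — for `t, ρ > 0` on the disc `a₀² + ρ² < 1`:
`periodicKernel L 0 1 t (t²) (a₀, ρ) = ofReal(4π) · ofReal ρ⁻¹ · twoScaleVolume L ρ (t/ρ²) a₀`
(✓`lintegral_volume3_eq_scaleQ3` with `(m, l) = (ρ, ρ⁻¹)`: the Jacobian `ρ⁻³` against the `ρ²` of ✓`periodicKernel`). [cite: Luscher1983, §2] [cite: GonzalezarroyoAltes1988] -/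
theorem periodicKernel_eq_twoScaleVolume (t : ℝ) {ρ : ℝ} (hρ : 0 < ρ) {a₀ : ℝ} (hin : a₀ ^ 2 + ρ ^ 2 < 1) :
    periodicKernel L (fun _ => false) (fun _ => 1) t (t ^ 2) (a₀, ρ) =
      ENNReal.ofReal (4 * Real.pi) * ENNReal.ofReal ρ⁻¹ * twoScaleVolume L ρ (t / ρ ^ 2) a₀ := by
  have hc : ENNReal.ofReal (ρ ^ 2) * (ENNReal.ofReal ρ⁻¹ * ENNReal.ofReal ρ⁻¹ * ENNReal.ofReal ρ⁻¹) = ENNReal.ofReal ρ⁻¹ := by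
    rw [← ENNReal.ofReal_mul (by positivity), ← ENNReal.ofReal_mul (by positivity), ← ENNReal.ofReal_mul (by positivity)]
    congr 1
    field_simp
  unfold periodicKernel
  simp only
  rw [Set.indicator_of_mem (show ρ ∈ {ρ : ℝ | a₀ ^ 2 + ρ ^ 2 < 1} from hin), periodicFibreMass_hubAt_eq_twoScaleVolume t hρ a₀,
    ← mul_assoc (ENNReal.ofReal (ρ ^ 2)), hc, mul_assoc]

/-- ★ Off the disc the kernel vanishes. [folklore] -/
theorem periodicKernel_eq_zero_of_not_mem (z : Fin 3 → Bool) (χ : Site 3 L → SU2) (t s : ℝ) {a₀ ρ : ℝ} (hout : ¬ a₀ ^ 2 + ρ ^ 2 < 1) :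
    periodicKernel L z χ t s (a₀, ρ) = 0 := by
  unfold periodicKernel
  rw [Set.indicator_of_notMem (show ρ ∉ {ρ : ℝ | a₀ ^ 2 + ρ ^ 2 < 1} from hout), mul_zero]

/-- ★ **The kernel identity in indicator form**, for every `t, ρ > 0` and every `a₀`. [folklore] -/
theorem periodicKernel_eq_indicator_twoScaleVolume (t : ℝ) {ρ : ℝ} (hρ : 0 < ρ) (a₀ : ℝ) :
    periodicKernel L (fun _ => false) (fun _ => 1) t (t ^ 2) (a₀, ρ) =
      ENNReal.ofReal (4 * Real.pi) * {p : ℝ × ℝ | p.1 ^ 2 + p.2 ^ 2 < 1}.indicator 1 (a₀, ρ) * ENNReal.ofReal ρ⁻¹ *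
        twoScaleVolume L ρ (t / ρ ^ 2) a₀ := by
  by_cases hin : a₀ ^ 2 + ρ ^ 2 < 1
  · rw [periodicKernel_eq_twoScaleVolume t hρ hin,
      Set.indicator_of_mem (show (a₀, ρ) ∈ {p : ℝ × ℝ | p.1 ^ 2 + p.2 ^ 2 < 1} from hin), Pi.one_apply, mul_one]
  · rw [periodicKernel_eq_zero_of_not_mem _ _ _ _ hin,
      Set.indicator_of_notMem (show (a₀, ρ) ∉ {p : ℝ × ℝ | p.1 ^ 2 + p.2 ^ 2 < 1} from hin), mul_zero, zero_mul, zero_mul]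

/-! ## §3 The crude bound (I2′) -/

/-- The `Vmax` of (I2′): `(4π)⁻¹ · (1/64) · C₀ · vol(domSet4)` with PD-II's constant `C₀ = 4π · vol^{Fol}(box) · (20L²)⁶`. [folklore] -/
theorem twoScaleVolume_le :
    ∃ Vmax : ℝ≥0∞, Vmax ≠ ∞ ∧ ∀ u s a₀ : ℝ, 0 < u → 0 < s → a₀ ^ 2 + u ^ 2 < 1 → twoScaleVolume L u s a₀ ≤ Vmax := by
  -- PD-II's constant at `r = 1`, `R = 20L²`
  set R : ℝ := 20 * (L : ℝ) ^ 2 with hRdef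
  have hL : (0 : ℝ) < L := by exact_mod_cast NeZero.pos L
  have hR : 0 < R := by positivity
  have hRr : 20 * (L : ℝ) ^ 2 * Real.sqrt 1 ≤ R := by rw [Real.sqrt_one, mul_one]
  set B : ℝ≥0∞ := (Measure.pi fun _ : Fol L => (volume : Measure ℍ))
    (Set.univ.pi fun _ : Fol L => {y : ℍ | |y.re| < 1 ∧ ‖y.im‖ ≤ 12 * (L : ℝ) ^ 2 * Real.sqrt 1}) with hB
  have hBfin : B ≠ ∞ := pi_volume_followerBox_ne_top _
  set D : ℝ≥0∞ := (((volume : Measure ℍ).prod (volume : Measure ℍ)).prod (volume : Measure ℍ)) domSet4 with hD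
  have hDfin : D ≠ ∞ := volume_domSet4_lt_top.ne
  set C₀ : ℝ≥0∞ := ENNReal.ofReal (4 * Real.pi) * (B * ENNReal.ofReal (R ^ 6)) with hC₀
  have hC₀fin : C₀ ≠ ∞ := ENNReal.mul_ne_top ENNReal.ofReal_ne_top (ENNReal.mul_ne_top hBfin ENNReal.ofReal_ne_top)
  refine ⟨ENNReal.ofReal (4 * Real.pi)⁻¹ * (C₀ * ENNReal.ofReal (1 / 64) * D),
    ENNReal.mul_ne_top ENNReal.ofReal_ne_top (ENNReal.mul_ne_top (ENNReal.mul_ne_top hC₀fin ENNReal.ofReal_ne_top) hDfin), ?_⟩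
  intro u s a₀ hu hs hin
  have hu0 : u ≠ 0 := hu.ne'
  -- scale `t = u²s`, so that `t/u² = s`
  set t : ℝ := u ^ 2 * s with ht
  have ht0 : 0 < t := by positivity
  have hts : t / u ^ 2 = s := by rw [ht]; field_simp
  -- (I1′) at `(t, ρ = u)` and PD-II's bound
  have hK := periodicKernel_le_radK (L := L) (r := 1) zero_le_one ht0 hR hRr a₀ hu
  rw [one_mul, periodicKernel_eq_twoScaleVolume t hu hin, hts] at hK
  -- `radK (R t) a₀ u ≤ ofReal(1/(64u)) · D` on the disc
  have hrad : radK (R * t) a₀ u ≤ ENNReal.ofReal (1 / 64) * ENNReal.ofReal u⁻¹ * D := by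
    rw [radK_eq hu hin]
    have h1 : (a₀ ^ 2 + u ^ 2) * Real.sqrt (a₀ ^ 2 + u ^ 2) / (64 * u) ≤ 1 / 64 * u⁻¹ := by
      have hs1 : Real.sqrt (a₀ ^ 2 + u ^ 2) ≤ 1 := by
        rw [← Real.sqrt_one]; exact Real.sqrt_le_sqrt hin.le
      have hs0 : 0 ≤ Real.sqrt (a₀ ^ 2 + u ^ 2) := Real.sqrt_nonneg _
      have hq : (a₀ ^ 2 + u ^ 2) * Real.sqrt (a₀ ^ 2 + u ^ 2) ≤ 1 := by nlinarith [sq_nonneg a₀, sq_nonneg u]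
      rw [div_le_iff₀ (by positivity)]
      calc (a₀ ^ 2 + u ^ 2) * Real.sqrt (a₀ ^ 2 + u ^ 2) ≤ 1 := hq
        _ = 1 / 64 * u⁻¹ * (64 * u) := by field_simp
    calc ENNReal.ofReal ((a₀ ^ 2 + u ^ 2) * Real.sqrt (a₀ ^ 2 + u ^ 2) / (64 * u)) * Vrad (R * t) a₀ u
        ≤ ENNReal.ofReal (1 / 64 * u⁻¹) * D := mul_le_mul' (ENNReal.ofReal_le_ofReal h1) (Vrad_le_domSet4 _ _ hu)
      _ = ENNReal.ofReal (1 / 64) * ENNReal.ofReal u⁻¹ * D := by rw [ENNReal.ofReal_mul (by norm_num)]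
  have hmain : ENNReal.ofReal u⁻¹ * (ENNReal.ofReal (4 * Real.pi) * twoScaleVolume L u s a₀) ≤
      ENNReal.ofReal u⁻¹ * (C₀ * ENNReal.ofReal (1 / 64) * D) := by
    calc ENNReal.ofReal u⁻¹ * (ENNReal.ofReal (4 * Real.pi) * twoScaleVolume L u s a₀)
        = ENNReal.ofReal (4 * Real.pi) * ENNReal.ofReal u⁻¹ * twoScaleVolume L u s a₀ := by ring
      _ ≤ C₀ * radK (R * t) a₀ u := hK
      _ ≤ C₀ * (ENNReal.ofReal (1 / 64) * ENNReal.ofReal u⁻¹ * D) := mul_le_mul' le_rfl hrad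
      _ = ENNReal.ofReal u⁻¹ * (C₀ * ENNReal.ofReal (1 / 64) * D) := by ring
  have hu_ne0 : ENNReal.ofReal u⁻¹ ≠ 0 := by
    rw [Ne, ENNReal.ofReal_eq_zero, not_le]; positivity
  have h4 := (ENNReal.mul_le_mul_iff_right hu_ne0 ENNReal.ofReal_ne_top).1 hmain
  -- divide by `4π`
  have hπ : ENNReal.ofReal (4 * Real.pi)⁻¹ * ENNReal.ofReal (4 * Real.pi) = 1 := by
    rw [← ENNReal.ofReal_mul (by positivity), inv_mul_cancel₀ (by positivity), ENNReal.ofReal_one]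
  calc twoScaleVolume L u s a₀
      = ENNReal.ofReal (4 * Real.pi)⁻¹ * (ENNReal.ofReal (4 * Real.pi) * twoScaleVolume L u s a₀) := by
        rw [← mul_assoc, hπ, one_mul]
    _ ≤ ENNReal.ofReal (4 * Real.pi)⁻¹ * (C₀ * ENNReal.ofReal (1 / 64) * D) := mul_le_mul' le_rfl h4

end Summit.QuantumFields.YangMills.Theorems.SwapVirialDeficit.BlowUpRing

end
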